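import Summits.ValiantsHypothesis.ValiantsHypothesis.Theorems.LacunarySymmetroidMatrixDescartesDoorA26WallBubblingConfluentNondeg
import Summits.ValiantsHypothesis.ValiantsHypothesis.Theorems.LacunarySymmetroidMatrixDescartesDoorA26WallBubblingBubblingInertiaClosed
import Summits.ValiantsHypothesis.ValiantsHypothesis.Theorems.LacunarySymmetroidMatrixDescartesDoorA26WallBubblingLevelSelectionMulti

/-!
# Wall bubbling for `DoorA26` — (W) chain piece: THE CONFLUENT LIMIT OF A CLUSTER (frame identity, Gram normalisation, realisable non-degenerate limit)

HONEST FRAMING.  Chain theorem for obligation (W) `stub_weylFaces` of `Cruxes/DoorA26/Lines/wall_bubbling.lean` (stmt-ValiantsHypothesis-19979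
`DoorA26`; OPEN, typed, never asserted), W2 seat val-sym-door-p1 g14; statement file `Cruxes/DoorA26/Lines/wall_bubbling_ConfluentDoor.lean` rev 3.
THE MIDDLE of the single-cluster branch of «`ConfluentDoor26` ⇒ `Stmt.weylFaces_generic`» (report DOOR-A-P1-REPORT §68 (f)–(g)), replacing the
moment / Vandermonde level selection of the g13 plan by an IDENTITY:

* `frame_sum`, `frame_det` — THE FRAME IDENTITY: for letters `U : Fin 6 → Sym₂(ℝ)` and exponents `δ` (Weyl pair at the positions `0, 5`,
  `w = δ₅ − δ₀`), `det(Σ_l e^{δ_l t}U_l) = Σ_pq polar(V_p,V_q)·c_p(t)c_q(t)` EXACTLY, with the CONFLUENT FRAME `V = (U₀+U₅, U₁, …, U₄, w·U₅)` and the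
  coefficient functions `c_l = e^{δ_l t}` (`l ≤ 4`), `c₅ = dslope (y ↦ e^{yt}) δ₀ δ₅` (Newton form of the merging pair; no case distinction in `w`);
  `frame_isSymm`, `contDiff_pencilDet`;
* **`confluentLimit`** — for ANY sequence of genuine `(2,6)` pencils `t ↦ det Σ_l e^{δ^ν_l t}U^ν_l` (each not identically zero) whose exponents converge
  to a generic Weyl face (`δ^ν → δ0`, `δ0 5 = δ0 0`, `δ0 ∘ castSucc` 2-Sidon): along a subsequence `φ`, after scalar normalisation `a_k`, the functions
  converge CONTINUOUSLY WITH ALL DERIVATIVES along every further subsequence and every convergent sequence of times to a confluent determinant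
  `det(e^{δ₀t}(τ + tT) + Σ_k e^{δ_{k+1}t}S_k)` with symmetric letters which is NOT identically zero — literally the hypotheses `hconv` / `hne` of W2 #7
  `no_twenty_window_of_confluentDoor` (p653192).  Mechanism: Gram-normalise the frame (one compactness extraction, `levelSelection_multi` p658176),
  closedness of `Realisable` (`realisable_of_tendsto` p619386), the calculus of `…ConfluentFrame`, non-degeneracy `…ConfluentNondeg`.

No new definitions; nothing here bears on `DoorA26`, `MatrixDescartes` (stmt-ValiantsHypothesis-18050) or `VP ≠ VNP`.

[folklore] Newton form of Hermite interpolation; compactness; closed cones.  [this work] the frame bookkeeping.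
-/

-- `Summit.ValiantsHypothesis.ValiantsHypothesis.…` repeats a component by the D-0017 layout
-- (single-conjunct summit), which the `dupNamespace` linter flags; the name is mandated.
set_option linter.dupNamespace false

namespace Summit.ValiantsHypothesis.ValiantsHypothesis.Theorems.LacunarySymmetroidMatrixDescartes.WallBubbling

open Finset Filter Topology Polynomial
open Bubbling (polar Realisable polar_comm polar_self det_sum_smul_fin_two realisable_polarGram realisable_smul realisable_of_tendsto)
open scoped BigOperators

/-! ## 1. The frame identity -/

/-- **THE FRAME IDENTITY (letters).**  `Σ_l e^{δ_l t}U_l = Σ_l c_l(t)•V_l` with the confluent frame `V` and coefficient functions `c`. [this work] -/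
theorem frame_sum (δ : Fin 6 → ℝ) (U : Fin 6 → Matrix (Fin 2) (Fin 2) ℝ) (t : ℝ) :
    ∑ l, Real.exp (δ l * t) • U l
      = ∑ l, (if l = 5 then dslope (fun y : ℝ => Real.exp (y * t)) (δ 0) (δ 5) else Real.exp (δ l * t)) •
          (if l = 0 then U 0 + U 5 else if l = 5 then (δ 5 - δ 0) • U 5 else U l) := by
  rw [sum_fin_six_split, sum_fin_six_split]
  have hmid : ∀ k : Fin 4,
      ((if (k.succ.castSucc : Fin 6) = 5 then dslope (fun y : ℝ => Real.exp (y * t)) (δ 0) (δ 5) else Real.exp (δ k.succ.castSucc * t)) •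
        (if (k.succ.castSucc : Fin 6) = 0 then U 0 + U 5 else if (k.succ.castSucc : Fin 6) = 5 then (δ 5 - δ 0) • U 5 else U k.succ.castSucc))
        = Real.exp (δ k.succ.castSucc * t) • U k.succ.castSucc := by
    intro k
    rw [if_neg (succ_castSucc_ne k).2, if_neg (succ_castSucc_ne k).1, if_neg (succ_castSucc_ne k).2]
  simp only [hmid]
  have h50 : ((5 : Fin 6) = 0) = False := by simp
  have h05 : ((0 : Fin 6) = 5) = False := by simp
  simp only [h50, h05, if_true, if_false]
  rw [smul_smul, mul_comm (dslope _ _ _) (δ 5 - δ 0), sub_mul_dslope_exp, sub_smul, smul_add]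
  abel

/-- **THE FRAME IDENTITY (determinant).**  The genuine pencil determinant is the quadratic form `Σ_pq polar(V_p,V_q)·c_p c_q`. [this work] -/
theorem frame_det (δ : Fin 6 → ℝ) (U : Fin 6 → Matrix (Fin 2) (Fin 2) ℝ) (t : ℝ) :
    (∑ l, Real.exp (δ l * t) • U l).det
      = ∑ p, ∑ q, polar (if p = 0 then U 0 + U 5 else if p = 5 then (δ 5 - δ 0) • U 5 else U p)
            (if q = 0 then U 0 + U 5 else if q = 5 then (δ 5 - δ 0) • U 5 else U q) *
          ((if p = 5 then dslope (fun y : ℝ => Real.exp (y * t)) (δ 0) (δ 5) else Real.exp (δ p * t)) *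
            (if q = 5 then dslope (fun y : ℝ => Real.exp (y * t)) (δ 0) (δ 5) else Real.exp (δ q * t))) := by
  rw [frame_sum, det_sum_smul_fin_two]
  refine Finset.sum_congr rfl fun p _ => Finset.sum_congr rfl fun q _ => ?_
  ring

/-- The frame of symmetric letters is symmetric. [folklore] -/
theorem frame_isSymm (δ : Fin 6 → ℝ) (U : Fin 6 → Matrix (Fin 2) (Fin 2) ℝ) (hU : ∀ l, (U l).IsSymm) (l : Fin 6) :
    (if l = 0 then U 0 + U 5 else if l = 5 then (δ 5 - δ 0) • U 5 else U l).IsSymm := by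
  split_ifs
  · exact (hU 0).add (hU 5)
  · exact (hU 5).smul _
  · exact hU l

/-- The genuine pencil determinant is smooth in `t`. [folklore] -/
theorem contDiff_pencilDet (δ : Fin 6 → ℝ) (U : Fin 6 → Matrix (Fin 2) (Fin 2) ℝ) (n : ℕ) :
    ContDiff ℝ n (fun t : ℝ => (∑ l, Real.exp (δ l * t) • U l).det) := by
  have h : (fun t : ℝ => (∑ l, Real.exp (δ l * t) • U l).det)
      = fun t => ∑ p, ∑ q, Real.exp (δ p * t) * Real.exp (δ q * t) * polar (U p) (U q) := by
    funext t; rw [det_sum_smul_fin_two]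
  rw [h]
  refine ContDiff.sum fun p _ => ContDiff.sum fun q _ => ?_
  exact ((contDiff_exp_const_mul' (δ p) n).mul (contDiff_exp_const_mul' (δ q) n)).mul contDiff_const

/-! ## 2. The confluent limit of a cluster -/

/-- **THE CONFLUENT LIMIT OF A CLUSTER.**  See the module docstring.  Positions: the Weyl pair sits at `0` and `5` (`δ^ν₀, δ^ν₅ → δ0 0 = δ0 5`),
the other four letters at `k.succ.castSucc`; `δ0 ∘ castSucc` is 2-Sidon (generic face).  Output: a subsequence `φ`, scalars `a`, symmetric limit
letters `τ, T, S`, the NON-DEGENERACY of the confluent determinant, and CONTINUOUS CONVERGENCE WITH ALL DERIVATIVES of the normalised genuine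
determinants along every further subsequence `ψ` and every convergent sequence of times. [this work] -/
theorem confluentLimit (δs : ℕ → Fin 6 → ℝ) (δ0 : Fin 6 → ℝ)
    (hδ : ∀ l, Tendsto (fun ν => δs ν l) atTop (𝓝 (δ0 l))) (h05 : δ0 5 = δ0 0)
    (hsid : ∀ a b c d : Fin 5, δ0 a.castSucc + δ0 b.castSucc = δ0 c.castSucc + δ0 d.castSucc → (a = c ∧ b = d) ∨ (a = d ∧ b = c))
    (U : ℕ → Fin 6 → Matrix (Fin 2) (Fin 2) ℝ) (hU : ∀ ν l, (U ν l).IsSymm)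
    (hne : ∀ ν, ∃ t, (∑ l, Real.exp (δs ν l * t) • U ν l).det ≠ 0) :
    ∃ φ : ℕ → ℕ, StrictMono φ ∧
    ∃ (a : ℕ → ℝ) (τ T : Matrix (Fin 2) (Fin 2) ℝ) (S : Fin 4 → Matrix (Fin 2) (Fin 2) ℝ),
      τ.IsSymm ∧ T.IsSymm ∧ (∀ k, (S k).IsSymm) ∧
      (∃ t, ((Real.exp (δ0 0 * t)) • (τ + t • T) + ∑ k : Fin 4, (Real.exp (δ0 k.succ.castSucc * t)) • S k).det ≠ 0) ∧
      ∀ (n : ℕ) (ψ : ℕ → ℕ), StrictMono ψ → ∀ (ts : ℕ → ℝ) (t₀ : ℝ), Tendsto ts atTop (𝓝 t₀) →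
        Tendsto (fun k => iteratedDeriv n (fun t => a (ψ k) * (∑ l, Real.exp (δs (φ (ψ k)) l * t) • U (φ (ψ k)) l).det) (ts k))
          atTop (𝓝 (iteratedDeriv n
            (fun t => ((Real.exp (δ0 0 * t)) • (τ + t • T) + ∑ k : Fin 4, (Real.exp (δ0 k.succ.castSucc * t)) • S k).det) t₀)) := by
  classical
  -- the frames, their polar Gram entries and the Gram normalisation
  set V : ℕ → Fin 6 → Matrix (Fin 2) (Fin 2) ℝ := fun ν l =>
    if l = 0 then U ν 0 + U ν 5 else if l = 5 then (δs ν 5 - δs ν 0) • U ν 5 else U ν l with hV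
  set M : ℕ → Fin 6 × Fin 6 → ℝ := fun ν pq => polar (V ν pq.1) (V ν pq.2) with hM
  set μ : ℕ → ℝ := fun ν => (univ : Finset (Fin 6 × Fin 6)).sup' (Finset.univ_nonempty) (fun pq => |M ν pq|) with hμ
  have hdom : ∀ ν pq, |M ν pq| ≤ μ ν := fun ν pq => Finset.le_sup' (fun pq => |M ν pq|) (Finset.mem_univ pq)
  have hatt : ∀ ν, ∃ pq, |M ν pq| = μ ν := by
    intro ν
    obtain ⟨pq, _, hpq⟩ := Finset.exists_mem_eq_sup' (Finset.univ_nonempty (α := Fin 6 × Fin 6)) (fun pq => |M ν pq|)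
    exact ⟨pq, hpq.symm⟩
  -- the frame identity at stage ν
  have hframe : ∀ ν t, (∑ l, Real.exp (δs ν l * t) • U ν l).det
      = ∑ p, ∑ q, M ν (p, q) * ((if p = 5 then dslope (fun y : ℝ => Real.exp (y * t)) (δs ν 0) (δs ν 5) else Real.exp (δs ν p * t)) *
          (if q = 5 then dslope (fun y : ℝ => Real.exp (y * t)) (δs ν 0) (δs ν 5) else Real.exp (δs ν q * t))) := by
    intro ν t
    rw [frame_det]
  have hμpos : ∀ ν, 0 < μ ν := by
    intro ν
    obtain ⟨t, ht⟩ := hne ν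
    rw [hframe ν t] at ht
    obtain ⟨p, _, hp⟩ := Finset.exists_ne_zero_of_sum_ne_zero ht
    obtain ⟨q, _, hq⟩ := Finset.exists_ne_zero_of_sum_ne_zero hp
    have hM0 : M ν (p, q) ≠ 0 := fun h => hq (by rw [h, zero_mul])
    exact lt_of_lt_of_le (abs_pos.mpr hM0) (hdom ν (p, q))
  -- one compactness extraction
  obtain ⟨φ, hφ, c, hc, -, hc1⟩ := levelSelection_multi M μ hμpos hdom hatt
  -- the limit Gram matrix is realisable
  have hreal : Realisable (Matrix.of fun p q => c (p, q)) := by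
    refine realisable_of_tendsto (Gseq := fun k => (μ (φ k))⁻¹ • Matrix.of fun p q => M (φ k) (p, q)) ?_ ?_
    · intro k
      exact realisable_smul _ (realisable_polarGram (V (φ k)) (fun l => frame_isSymm (δs (φ k)) (U (φ k)) (hU (φ k)) l))
    · refine tendsto_pi_nhds.mpr fun p => tendsto_pi_nhds.mpr fun q => ?_
      have := hc (p, q)
      simp only [Matrix.smul_apply, Matrix.of_apply, smul_eq_mul]
      simpa [div_eq_inv_mul] using this
  obtain ⟨ε, W, hε, hW, hGW⟩ := hreal
  have hε2 : ε * ε = 1 := by rcases hε with rfl | rfl <;> norm_num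
  -- limit entries in terms of the realising letters
  have hcW : ∀ p q, ε * c (p, q) = polar (W p) (W q) := by
    intro p q
    have := hGW p q
    simp only [Matrix.of_apply] at this
    rw [this, ← mul_assoc, hε2, one_mul]
  -- some polar entry of `W` is non-zero
  have hWne : ∃ p q, polar (W p) (W q) ≠ 0 := by
    obtain ⟨⟨p, q⟩, hpq⟩ := hc1
    refine ⟨p, q, ?_⟩
    rw [← hcW]
    intro h
    rcases mul_eq_zero.mp h with h1 | h1
    · rcases hε with rfl | rfl <;> norm_num at h1
    · rw [h1, abs_zero] at hpq; norm_num at hpq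
  refine ⟨φ, hφ, fun k => ε * (μ (φ k))⁻¹, W 0, W 5, fun k => W k.succ.castSucc, hW 0, hW 5, fun k => hW _,
    confluentDet_ne_zero_of_polar_ne_zero δ0 h05 hsid W hWne, ?_⟩
  -- continuous convergence with all derivatives
  intro n ψ hψ ts t₀ hts
  have hφψ : Tendsto (fun k => φ (ψ k)) atTop atTop := hφ.tendsto_atTop.comp hψ.tendsto_atTop
  -- rewrite approximants and limit as quadratic forms
  have happrox : ∀ k, (fun t => ε * (μ (φ (ψ k)))⁻¹ * (∑ l, Real.exp (δs (φ (ψ k)) l * t) • U (φ (ψ k)) l).det)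
      = fun t => ∑ p, ∑ q, (ε * (M (φ (ψ k)) (p, q) / μ (φ (ψ k)))) *
          ((if p = 5 then dslope (fun y : ℝ => Real.exp (y * t)) (δs (φ (ψ k)) 0) (δs (φ (ψ k)) 5) else Real.exp (δs (φ (ψ k)) p * t)) *
            (if q = 5 then dslope (fun y : ℝ => Real.exp (y * t)) (δs (φ (ψ k)) 0) (δs (φ (ψ k)) 5) else Real.exp (δs (φ (ψ k)) q * t))) := by
    intro k; funext t
    rw [hframe, Finset.mul_sum]
    refine Finset.sum_congr rfl fun p _ => ?_
    rw [Finset.mul_sum]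
    refine Finset.sum_congr rfl fun q _ => ?_
    rw [div_eq_mul_inv]; ring
  have hlimit : (fun t => ((Real.exp (δ0 0 * t)) • (W 0 + t • W 5) + ∑ k : Fin 4, (Real.exp (δ0 k.succ.castSucc * t)) • W k.succ.castSucc).det)
      = fun t => ∑ p, ∑ q, polar (W p) (W q) *
          ((if p = 5 then dslope (fun y : ℝ => Real.exp (y * t)) (δ0 0) (δ0 0) else Real.exp (δ0 p * t)) *
            (if q = 5 then dslope (fun y : ℝ => Real.exp (y * t)) (δ0 0) (δ0 0) else Real.exp (δ0 q * t))) := by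
    funext t; exact confluentDet_eq_quadForm δ0 W t
  rw [hlimit]
  simp only [happrox]
  -- apply the Leibniz bookkeeping of `…ConfluentFrame`
  refine tendsto_iteratedDeriv_quadForm (ι := Fin 6)
    (fun k p q => ε * (M (φ (ψ k)) (p, q) / μ (φ (ψ k))))
    (fun p q => polar (W p) (W q))
    (fun k p t => if p = 5 then dslope (fun y : ℝ => Real.exp (y * t)) (δs (φ (ψ k)) 0) (δs (φ (ψ k)) 5) else Real.exp (δs (φ (ψ k)) p * t))
    (fun p t => if p = 5 then dslope (fun y : ℝ => Real.exp (y * t)) (δ0 0) (δ0 0) else Real.exp (δ0 p * t))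
    ?_ ?_ ts t₀ ?_ ?_ n
  · intro k p m
    by_cases hp : p = 5
    · simp only [hp, if_true]; exact contDiff_dslope_exp _ _ m
    · simp only [hp, if_false]; exact contDiff_exp_const_mul' _ m
  · intro p m
    by_cases hp : p = 5
    · simp only [hp, if_true]; exact contDiff_dslope_exp _ _ m
    · simp only [hp, if_false]; exact contDiff_exp_const_mul' _ m
  · intro p q
    rw [← hcW p q]
    exact ((hc (p, q)).comp hψ.tendsto_atTop).const_mul ε
  · intro p i
    by_cases hp : p = 5
    · simp only [hp, if_true]
      exact tendsto_iteratedDeriv_dslope_exp i ((hδ 0).comp hφψ) (by rw [← h05]; exact (hδ 5).comp hφψ) hts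
    · simp only [hp, if_false]
      exact tendsto_iteratedDeriv_exp i ((hδ p).comp hφψ) hts

end Summit.ValiantsHypothesis.ValiantsHypothesis.Theorems.LacunarySymmetroidMatrixDescartes.WallBubbling
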